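import Summits.BirchSwinnertonDyer.BirchSwinnertonDyer.Theses.SchneiderFreeAdditiveX3
import Summits.BirchSwinnertonDyer.BirchSwinnertonDyer.Theorems.SchneiderFreeAdditiveX3AnticycControlAdditiveRegimeB1
import Summits.BirchSwinnertonDyer.Rank1Residual.X11b.LocalPrimaryCohomologyEP
import Literature.NumberTheory.GaloisRepresentations.NumberFieldCdTwoProofs
import HarnessLib

/-!
# Route `SchneiderFreeAdditiveX3`, item `ControlNoGlobalPTorsionF` (stmt-BirchSwinnertonDyer-19545) — CLOSED

Regime B1 of the control corner of the K1 door (board row B6 ∩ X3 ∩ sst-twist, `r = 1`): the frames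
with NO GLOBAL `p`-torsion (`E(K)[p] = 0` in Mordell–Weil form), GIVEN Fin_v on the cell (the unfolded
`Set.Finite` form of `SchneiderFreeControlAtoms.LocalTowerTorsionFiniteAt (W.baseChange K) p κ 𝔭` at
every imaginary quadratic `K` with `p` split, every anticyclotomic `κ` and every `𝔭 ∣ p`), stated under
the four cite-only facts of `ControlFacts` (Poitou–Tate duality for Selmer structures, Poitou–Tate
duality for `Ш`, Brink 2007 Thm. 2, Brink 2007 Cor. 1) and Kolyvagin as explicit antecedents.

The proof is door-c4 gen 2's pointwise engine
`additiveControlOnTreeAt_of_facts_of_localTowerTorsionFinite` (file `…AnticycControlAdditiveRegimeB1.lean`,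
p435075) fed: the facts at `K`, the local Euler–Poincaré characteristic at every completion
(`X11b.LocBridge.localEulerPoincareCharacteristic_adicCompletionEP`, a tree theorem), `cd_p ≤ 2`
(`fieldCdLE_two_of_numberField_holds`, a tree theorem), `p` split in `K` from the Heegner hypothesis,
`rank E(K) = 1` and `Ш(E/K)` finite from Kolyvagin, Fin_v at the frame from the item's own hypothesis
(definitionally `LocalTowerTorsionFiniteAt`), and non-splitting of `𝔭` in `K_∞^{ac}` from Brink Cor. 1.
This also lands the registered stub `stub_regimeB1` (by name) of the v4-KF skeleton `3dbdb197…` of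
crux `AnticycControlAdditiveKF` (stmt-BirchSwinnertonDyer-19548). CONDITIONAL on the cited facts
carried INSIDE the item's statement; closes nothing about BSD by itself.

References: [JetchevSkinnerWan2017] §3.2–3.3, Thm. 3.3.1, Prop. 3.3.4 Case 3(b); [Castella2018] Thm. 2.3;
[MilneADT2006] I 2.8, 4.10; [Brink2007] Thm. 2, Cor. 1; [Kolyvagin1990] Thm. A;
[SerreGaloisCohomology1997] II §4.4 Prop. 13; [GreenbergLNM1716] §3 Lemma 3.3.
-/

noncomputable section

open scoped Classical

open Field NumberField IsDedekindDomain WeierstrassCurve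
open Literature.NumberTheory.EllipticCurves Literature.NumberTheory.EllipticCurves.GreenbergSelmer
open Literature.NumberTheory.GaloisRepresentations
open Literature.NumberTheory.GaloisCohomology
open Literature.NumberTheory.EllipticCurves.ModularForms
  Literature.NumberTheory.EllipticCurves.Rank1Residual
  Literature.NumberTheory.EllipticCurves.Rank1Residual.Typed
  Summit.BirchSwinnertonDyer.Rank1Residual
  Summit.BirchSwinnertonDyer.Rank1Residual.X11b
  Summit.BirchSwinnertonDyer.Rank1Residual.X11b.AcSelmer
  Summit.BirchSwinnertonDyer.BirchSwinnertonDyer.Theorems.SchneiderFree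
  Summit.BirchSwinnertonDyer.BirchSwinnertonDyer.Theorems.SchneiderFreeControlAtoms

set_option linter.dupNamespace false

namespace Summit.BirchSwinnertonDyer.BirchSwinnertonDyer.Theorems.SchneiderFreeAdditiveX3

/-- **Item `ControlNoGlobalPTorsionF` of route `SchneiderFreeAdditiveX3` holds** (regime B1 of the
control corner: the frames with `E(K)[p] = 0`, given Fin_v on the cell): door-c4 gen 2's
`additiveControlOnTreeAt_of_facts_of_localTowerTorsionFinite` with the local Euler–Poincaré
characteristic and `cd_p ≤ 2` supplied by the tree, `p` split from the Heegner hypothesis,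
`rank E(K) = 1 ∧ #Ш(E/K) < ∞` from Kolyvagin, Fin_v at the frame from the item's hypothesis and the
non-splitting of `𝔭` in `K_∞^{ac}` from Brink 2007 Cor. 1. CONDITIONAL on the cited facts that are
antecedents of the statement itself. [cite: JetchevSkinnerWan2017, Thm. 3.3.1 (arXiv:1512.06894 p. 11)]
[cite: MilneADT2006, Ch. I, Thm. 4.10 and Thm. 2.8] [cite: Brink2007, Thm. 2 and Cor. 1]
[cite: Kolyvagin1990, Thm. A] -/
theorem controlNoGlobalPTorsionF_holds :
    Summit.BirchSwinnertonDyer.BirchSwinnertonDyer.Theses.SchneiderFreeAdditiveX3.ControlNoGlobalPTorsionF := by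
  intro hPT hPT2 hBr hBrA hKo W _ _ p _ hr hp2 hX hS hFin N _ K _ _ Dt H ι P hr' hloc hN hK hodd hunit hHe
    hL1 hP hnt κ hκ γ _ 𝔭 h𝔭 he hf hivK
  have hpN : p ∣ W.conductorNorm ℤ := dvd_conductorNorm_of_n10Locus hloc
  have hsplit : SplitsIn K p := splitsIn_of_satisfiesHeegnerHypothesis hN hHe hpN
  obtain ⟨hrank, hSha⟩ := hKo N W K hK hHe ⟨Dt, H, ι, hP⟩ hnt
  exact additiveControlOnTreeAt_of_facts_of_localTowerTorsionFinite (hPT K) (hPT2 K)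
    (fun v ↦ Summit.BirchSwinnertonDyer.Rank1Residual.X11b.LocBridge.localEulerPoincareCharacteristic_adicCompletionEP K v)
    Literature.NumberTheory.GaloisRepresentations.fieldCdLE_two_of_numberField_holds (hBr K p) hp2
    hloc.2.1 hK hsplit hκ γ 𝔭 h𝔭 he hf hivK (hFin K hK hsplit κ hκ 𝔭 h𝔭) (hBrA K p hK hp2 κ hκ 𝔭 h𝔭)
    hrank hSha P hnt

/-- The registered stub `stub_regimeB1` of the v4-KF skeleton (crux `AnticycControlAdditiveKF`,
stmt-BirchSwinnertonDyer-19548), which is the item BY NAME. [folklore] -/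
theorem stub_regimeB1 :
    Summit.BirchSwinnertonDyer.BirchSwinnertonDyer.Theses.SchneiderFreeAdditiveX3.ControlNoGlobalPTorsionF :=
  controlNoGlobalPTorsionF_holds

end Summit.BirchSwinnertonDyer.BirchSwinnertonDyer.Theorems.SchneiderFreeAdditiveX3

end
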